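import Literature.Probability.RandomPlanarGeometry.SAWBridgeRenewalEquation
import Literature.Probability.RandomPlanarGeometry.SAWBridgeRenewalLimit
import Literature.Probability.RandomPlanarGeometry.SAWKestenRelation
import Literature.Probability.RandomPlanarGeometry.SAWKestenBridgeMeasure
import Literature.Probability.RandomPlanarGeometry.SAWHalfSpaceCylinders
import Mathlib.Topology.Algebra.InfiniteSum.NatInt
import HarnessLib

/-!
# Kesten's infinite-bridge measure, II: the identities (8.3.5) and (8.3.8) of Madras–Slade

Topic `Literature/Probability/RandomPlanarGeometry` (continues `SAWBridgeRenewalEquation.lean`).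

Source: N. Madras, G. Slade, *The Self-Avoiding Walk* (1993), §8.3 "The infinite bridge", book
pp. 272–274 (held text `book:madras1993-self-avoiding-walk` p0284–p0286). For an `m`-step self-avoiding
walk `ω` and `n ≥ m`, `F_n(ω)` is the set of `n`-step self-avoiding walks extending `ω`, and for a bridge
`β ∈ F_n(ω) ∩ B_n`, `M(β, ω)` is its first break point (renewal time) `≥ m`; `E_k(ω)` is the set of
`k`-step bridges `β` extending `ω` with `M(β, ω) = k`, i.e. with no break point in `[m, k)`. Then

* (8.3.5) `|F_n(ω) ∩ B_n| = Σ_{k=m}^{n} |E_k(ω)| b_{n-k}` (split at `M`);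
* (8.3.8) `|E_k(ω)| ≤ Σ_{i} λ_{k-i}` over the break points `i < m` preceding `m` (split at the LAST break
  point before `m`: the piece after it is an irreducible bridge). We prove the sharper summed identity
  `Σ_{ω ∈ S_m} |E_k(ω)| = #{β ∈ B_k : no break point in [m,k)} = Σ_{i<m} b_i λ_{k-i}` (`1 ≤ m ≤ k`) and the
  pointwise bound `|E_k(ω)| ≤ Σ_{i<m} λ_{k-i}`.

The objects `bridgeExtCount` (`|F_n(ω) ∩ B_n|`), `eCount` (`|E_k(ω)|`), `kestenCyl` (`P^B_m(ω)`, (8.3.6))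
and Theorem 8.3.1 from the two identities are `SAWKestenBridgeMeasure.lean`; here the identities are
PROVED, making Theorem 8.3.1 unconditional (`MadrasSlade1993_thm831`), and the cylinder weights are
shown to be normalised: `Σ_{ω ∈ S_m} P^B_m(ω) = 1` (`sum_kestenCyl_eq_one`, via (8.3.8) and the renewal
conservation law (B.5)).
-/

noncomputable section

open Finset Filter Topology Literature.Probability.LatticeModels Literature.Probability.Percolation
open scoped BigOperators

namespace Literature.Probability.RandomPlanarGeometry.SAW.Zd

variable {d : ℕ} [NeZero d]

/-! ### Renewal times of glued and restricted walks -/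

/-- `0` is a renewal time of every bridge. [cite: DuminilCopinHammond2013, §2.2] -/
theorem isRenewalTime_zero {n : ℕ} {ω : ℕ → Site d} (h : IsBridge n ω) : IsRenewalTime n ω 0 := by
  refine ⟨Nat.zero_le _, isBridge_zero _, ?_⟩
  simp only [Nat.sub_zero, zero_add]
  exact h

/-- Renewal times are translation invariant. [cite: DuminilCopinHammond2013, §2.2] -/
theorem isRenewalTime_sub_const_iff {n i : ℕ} {ω : ℕ → Site d} (c : Site d) :
    IsRenewalTime n (fun j => ω j - c) i ↔ IsRenewalTime n ω i := by
  unfold IsRenewalTime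
  rw [isBridge_sub_const_iff c, isBridge_sub_const_iff (ω := fun k => ω (i + k)) c]

/-- A renewal time `j ≤ s` of a glued walk `η ⊕ₛ τ` is a renewal time of the first piece `η`.
[cite: MadrasSlade1993, §4.2, (4.2.2)] -/
theorem IsRenewalTime.concatWalk_left {n s j : ℕ} {η τ : ℕ → Site d}
    (hj : IsRenewalTime n (concatWalk s η τ) j) (hjs : j ≤ s) (hsn : s ≤ n) (hη : IsBridge s η) :
    IsRenewalTime s η j :=
  (hj.of_le hjs hsn (isBridge_concatWalk_left.2 hη)).congr fun i hi => by
    rw [concatWalk_apply_of_le η τ hi]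

/-- A renewal time `j ≥ s` of a glued bridge `η ⊕ₛ τ` is (after the shift by `s`) a renewal time of the
second piece `τ`. [cite: MadrasSlade1993, §4.2, (4.2.2)] -/
theorem IsRenewalTime.concatWalk_right {n s j : ℕ} {η τ : ℕ → Site d}
    (hj : IsRenewalTime n (concatWalk s η τ) j) (hsj : s ≤ j) (hτ0 : τ 0 = 0)
    (hτb : IsBridge (n - s) τ) : IsRenewalTime (n - s) τ (j - s) := by
  obtain ⟨hjn, h1, h2⟩ := hj
  refine ⟨by omega, ?_, ?_⟩
  · -- `τ[0, j-s]` is a bridge: restrict the tail bridge of the glued walk to `[s, j]`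
    have htail : IsBridge (n - s) (fun i => concatWalk s η τ (s + i)) :=
      (isBridge_concatWalk_right hτ0).2 hτb
    have hres := htail.restrict hsj hjn h1
    exact (isBridge_concatWalk_right (m := s) (t := j - s) hτ0).1 hres
  · -- `τ[j-s, n-s]` is a bridge: it is the tail `[j, n]` of the glued walk, translated
    have hfun : (fun i => concatWalk s η τ (j + i)) = fun i => η s + τ (j - s + i) := by
      funext i
      rw [show j + i = s + (j - s + i) by omega, concatWalk_apply_add η τ hτ0]
    rw [hfun, isBridge_add_const_iff] at h2
    rwa [show n - s - (j - s) = n - j by omega]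

/-- A renewal time `j'` of the tail `ω[s, n]` (after a renewal time `s`) gives the renewal time
`s + j'` of `ω[0, n]`. [cite: MadrasSlade1993, §4.2, Definition 4.2.1] -/
theorem IsRenewalTime.add_of_tail {n s j' : ℕ} {ω : ℕ → Site d} (hs : IsRenewalTime n ω s)
    (hj : IsRenewalTime (n - s) (fun i => ω (s + i)) j') : IsRenewalTime n ω (s + j') := by
  obtain ⟨hsn, hsb, -⟩ := hs
  obtain ⟨hj'n, hj1, hj2⟩ := hj
  refine ⟨by omega, hsb.append hj1, ?_⟩
  have hfun : (fun i => ω (s + (j' + i))) = fun i => ω (s + j' + i) := by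
    funext i; rw [add_assoc]
  rw [hfun] at hj2
  rwa [show n - s - j' = n - (s + j') by omega] at hj2

/-! ### (8.3.5): splitting the bridges extending `ω` at the first break point `≥ m` -/

open Classical in
/-- The finite set `E_k(ω)` behind `eCount`. [cite: MadrasSlade1993, §8.3, p. 273] -/
private def eSet (k m : ℕ) (ω : ℕ → Site d) : Finset (ℕ → Site d) :=
  (bridges d k).filter fun β : ℕ → Site d =>
    (∀ j, j ≤ m → β j = ω j) ∧ ∀ i, m ≤ i → i < k → ¬ IsRenewalTime k β i

/-- `|E_k(ω)|` is the cardinality of the private finset `eSet`. [folklore] -/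
private theorem eCount_eq_card (k m : ℕ) (ω : ℕ → Site d) :
    eCount d k m ω = (eSet k m ω).card := rfl

/-- Membership in `eSet`. [folklore] -/
private theorem mem_eSet {k m : ℕ} {ω β : ℕ → Site d} :
    β ∈ eSet k m ω ↔
      β ∈ bridges d k ∧ (∀ j, j ≤ m → β j = ω j) ∧ ∀ i, m ≤ i → i < k → ¬ IsRenewalTime k β i := by
  classical
  unfold eSet
  rw [Finset.mem_filter]

/-- **Madras–Slade (8.3.5)**: for an `m`-step walk `ω` and `n ≥ m`,
`|F_n(ω) ∩ B_n| = Σ_{k=m}^{n} |E_k(ω)|·b_{n-k}` — every `n`-step bridge extending `ω` is, in exactly one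
way, a member of `E_k(ω)` (`k` = its first break point `≥ m`) followed by an `(n-k)`-step bridge.
[cite: MadrasSlade1993, §8.3, eq. (8.3.5) (p. 273)] -/
theorem bridgeExtCount_eq_sum_eCount (n m : ℕ) (hmn : m ≤ n) (ω : ℕ → Site d) :
    bridgeExtCount d n m ω = ∑ k ∈ Icc m n, eCount d k m ω * bridgeCount d (n - k) := by
  classical
  have hcard : ((Icc m n).sigma fun k => eSet k m ω ×ˢ bridges d (n - k)).card =
      ∑ k ∈ Icc m n, eCount d k m ω * bridgeCount d (n - k) := by
    rw [card_sigma]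
    refine Finset.sum_congr rfl fun k _ => ?_
    rw [card_product, eCount_eq_card, bridgeCount]
  rw [← hcard, bridgeExtCount]
  symm
  refine card_nbij (fun p => concatWalk p.1 p.2.1 p.2.2) ?_ ?_ ?_
  · -- the gluing lands in the bridges extending `ω`
    rintro ⟨k, η, τ⟩ hp
    simp only [mem_coe, mem_sigma, mem_Icc, mem_product] at hp
    obtain ⟨⟨hmk, hkn⟩, hη, hτ⟩ := hp
    obtain ⟨hηb, hηω, -⟩ := mem_eSet.1 hη
    rw [mem_coe, Finset.mem_filter]
    refine ⟨concatWalk_mem_bridges hkn hηb hτ, fun j hj => ?_⟩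
    dsimp only
    rw [concatWalk_apply_of_le η τ (hj.trans hmk)]
    exact hηω j hj
  · -- injectivity: the gluing time is the first break point `≥ m`
    rintro ⟨k, η, τ⟩ hp ⟨k', η', τ'⟩ hp' h
    simp only [mem_coe, mem_sigma, mem_Icc, mem_product] at hp hp'
    obtain ⟨⟨hmk, hkn⟩, hη, hτ⟩ := hp
    obtain ⟨⟨hmk', hkn'⟩, hη', hτ'⟩ := hp'
    obtain ⟨hηb, -, hηE⟩ := mem_eSet.1 hη
    obtain ⟨hηb', -, hηE'⟩ := mem_eSet.1 hη'
    dsimp only at h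
    have hren := isRenewalTime_concatWalk hkn hηb hτ
    have hren' := isRenewalTime_concatWalk hkn' hηb' hτ'
    obtain rfl : k = k' := by
      by_contra hne
      rcases lt_or_gt_of_ne hne with hlt | hlt
      · rw [h] at hren
        exact hηE' k hmk hlt (hren.concatWalk_left hlt.le hkn' (mem_bridges.1 hηb').2)
      · rw [← h] at hren'
        exact hηE k' hmk' hlt (hren'.concatWalk_left hlt.le hkn (mem_bridges.1 hηb).2)
    obtain ⟨h1, h2⟩ := concatWalk_injective_pieces (mem_bridges.1 hηb).1 (mem_bridges.1 hτ).1
      (mem_bridges.1 hηb').1 (mem_bridges.1 hτ').1 h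
    subst h1 h2
    rfl
  · -- surjectivity: split at the first break point `M ≥ m`
    intro β hβ
    rw [mem_coe, Finset.mem_filter] at hβ
    obtain ⟨hβb, hβω⟩ := hβ
    have hβbr : IsBridge n β := (mem_bridges.1 hβb).2
    have hex : ∃ j, m ≤ j ∧ IsRenewalTime n β j := ⟨n, hmn, isRenewalTime_self hβbr⟩
    set M := Nat.find hex with hMdef
    obtain ⟨hmM, hM⟩ : m ≤ M ∧ IsRenewalTime n β M := Nat.find_spec hex
    have hmin : ∀ j, m ≤ j → j < M → ¬ IsRenewalTime n β j := fun j hj hjM hren =>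
      Nat.find_min hex hjM ⟨hj, hren⟩
    have hMn : M ≤ n := hM.1
    refine ⟨⟨M, fun i => β (min i M), fun j => β (M + j) - β M⟩, ?_, concatWalk_head_tail β⟩
    simp only [mem_coe, mem_sigma, mem_Icc, mem_product]
    refine ⟨⟨hmM, hMn⟩, mem_eSet.2 ⟨headWalk_mem_bridges hβb hM, fun j hj => ?_, fun i hi hiM hren => ?_⟩,
      tailShift_mem_bridges hβb hM⟩
    · simp only [min_eq_left (hj.trans hmM)]
      exact hβω j hj
    · -- a renewal time of the head in `[m, M)` would be one of `β`
      have hren' : IsRenewalTime M β i :=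
        hren.congr fun j hj => by simp only [min_eq_left hj]
      exact hmin i hi hiM (hren'.trans hM)

/-! ### (8.3.8): splitting at the last break point before `m` -/

variable (d) in
open Classical in
/-- The `k`-step bridges with no break point in `[m, k)`. [cite: MadrasSlade1993, §8.3, p. 273] -/
private def noBreak (k m : ℕ) : Finset (ℕ → Site d) :=
  (bridges d k).filter fun β : ℕ → Site d => ∀ i, m ≤ i → i < k → ¬ IsRenewalTime k β i

/-- Membership in `noBreak`. [folklore] -/
private theorem mem_noBreak {k m : ℕ} {β : ℕ → Site d} :
    β ∈ noBreak d k m ↔ β ∈ bridges d k ∧ ∀ i, m ≤ i → i < k → ¬ IsRenewalTime k β i := by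
  classical
  unfold noBreak
  rw [Finset.mem_filter]

variable (d) in
/-- `#{β ∈ B_k : no break point in [m,k)} = Σ_{i<m} b_i λ_{k-i}` for `1 ≤ m ≤ k`: split at the LAST break
point `i < m`; the piece after it has no interior break point, i.e. is an irreducible bridge.
[cite: MadrasSlade1993, §8.3, eq. (8.3.8) (p. 273)] -/
private theorem card_noBreak (k m : ℕ) (hm : 1 ≤ m) (hmk : m ≤ k) :
    (noBreak d k m).card =
      ∑ i ∈ Finset.range m, bridgeCount d i * irreducibleBridgeCount d (k - i) := by
  classical
  have hcard : ((Finset.range m).sigma fun i => bridges d i ×ˢ irreducibleBridges d (k - i)).card =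
      ∑ i ∈ Finset.range m, bridgeCount d i * irreducibleBridgeCount d (k - i) := by
    rw [card_sigma]
    refine Finset.sum_congr rfl fun i _ => ?_
    rw [card_product, bridgeCount, irreducibleBridgeCount]
  rw [← hcard]
  symm
  refine card_nbij (fun p => concatWalk p.1 p.2.1 p.2.2) ?_ ?_ ?_
  · -- the gluing has no break point in `[m, k)`: such a break point would be an interior one of `τ`
    rintro ⟨i, η, τ⟩ hp
    simp only [mem_coe, mem_sigma, Finset.mem_range, mem_product] at hp
    obtain ⟨him, hη, hτ⟩ := hp
    have hik : i ≤ k := by omega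
    have hτb := irreducibleBridges_subset_bridges (k - i) hτ
    obtain ⟨-, -, -, hirr⟩ := mem_irreducibleBridges.1 hτ
    rw [mem_coe, mem_noBreak]
    dsimp only
    refine ⟨concatWalk_mem_bridges hik hη hτb, fun j hmj hjk hren => ?_⟩
    have h := hren.concatWalk_right (by omega) (mem_saws.1 (mem_bridges.1 hτb).1).1 (mem_bridges.1 hτb).2
    exact hirr (j - i) (by omega) (by omega) h
  · -- injectivity: the gluing time is the last break point before `m`
    rintro ⟨i, η, τ⟩ hp ⟨i', η', τ'⟩ hp' h
    simp only [mem_coe, mem_sigma, Finset.mem_range, mem_product] at hp hp'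
    obtain ⟨him, hη, hτ⟩ := hp
    obtain ⟨him', hη', hτ'⟩ := hp'
    have hτb := irreducibleBridges_subset_bridges (k - i) hτ
    have hτb' := irreducibleBridges_subset_bridges (k - i') hτ'
    obtain ⟨-, -, -, hirr⟩ := mem_irreducibleBridges.1 hτ
    obtain ⟨-, -, -, hirr'⟩ := mem_irreducibleBridges.1 hτ'
    dsimp only at h
    have hren := isRenewalTime_concatWalk (by omega : i ≤ k) hη hτb
    have hren' := isRenewalTime_concatWalk (by omega : i' ≤ k) hη' hτb'
    obtain rfl : i = i' := by
      by_contra hne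
      rcases lt_or_gt_of_ne hne with hlt | hlt
      · -- `i'` is a break point of `η ⊕ᵢ τ` beyond `i`: an interior break point of `τ`
        rw [← h] at hren'
        have := hren'.concatWalk_right hlt.le (mem_saws.1 (mem_bridges.1 hτb).1).1 (mem_bridges.1 hτb).2
        exact hirr (i' - i) (by omega) (by omega) this
      · rw [h] at hren
        have := hren.concatWalk_right hlt.le (mem_saws.1 (mem_bridges.1 hτb').1).1 (mem_bridges.1 hτb').2
        exact hirr' (i - i') (by omega) (by omega) this
    obtain ⟨h1, h2⟩ := concatWalk_injective_pieces (mem_bridges.1 hη).1 (mem_bridges.1 hτb).1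
      (mem_bridges.1 hη').1 (mem_bridges.1 hτb').1 h
    subst h1 h2
    rfl
  · -- surjectivity: split at the last break point `I < m`
    intro β hβ
    rw [mem_coe, mem_noBreak] at hβ
    obtain ⟨hβb, hβE⟩ := hβ
    have hβbr : IsBridge k β := (mem_bridges.1 hβb).2
    set I := Nat.findGreatest (fun j => IsRenewalTime k β j) (m - 1) with hIdef
    have hI : IsRenewalTime k β I := by
      have h0 : IsRenewalTime k β 0 := isRenewalTime_zero hβbr
      by_cases hI0 : I = 0
      · rw [hI0]; exact h0
      · exact Nat.findGreatest_of_ne_zero hIdef.symm hI0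
    have hIm : I ≤ m - 1 := Nat.findGreatest_le _
    have hmax : ∀ j, I < j → j ≤ m - 1 → ¬ IsRenewalTime k β j := fun j hIj hjm =>
      Nat.findGreatest_is_greatest hIj hjm
    have hIk : I ≤ k := hI.1
    refine ⟨⟨I, fun i => β (min i I), fun j => β (I + j) - β I⟩, ?_, concatWalk_head_tail β⟩
    simp only [mem_coe, mem_sigma, Finset.mem_range, mem_product]
    refine ⟨by omega, headWalk_mem_bridges hβb hI, ?_⟩
    -- the tail is irreducible: an interior break point would be a break point of `β` beyond `I`
    have htail := tailShift_mem_bridges hβb hI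
    refine mem_irreducibleBridges.2 ⟨htail, by omega, (mem_bridges.1 htail).2, fun j hj1 hj2 hren => ?_⟩
    have hren' : IsRenewalTime (k - I) (fun i => β (I + i)) j :=
      (isRenewalTime_sub_const_iff (ω := fun i => β (I + i)) (β I)).1 hren
    have hβj : IsRenewalTime k β (I + j) := hI.add_of_tail hren'
    by_cases hjm : I + j ≤ m - 1
    · exact hmax (I + j) (by omega) hjm hβj
    · exact hβE (I + j) (by omega) (by omega) hβj

variable (d) in
/-- **Madras–Slade (8.3.8), summed over the cylinders**: for `1 ≤ m ≤ k`,
`Σ_{ω ∈ S_m} |E_k(ω)| = Σ_{i<m} b_i λ_{k-i}` (the `k`-step bridges with no break point in `[m,k)`,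
classified by their first `m` steps, resp. by their last break point `i < m`).
[cite: MadrasSlade1993, §8.3, eq. (8.3.8) (p. 273)] -/
theorem sum_eCount_eq (k m : ℕ) (hm : 1 ≤ m) (hmk : m ≤ k) :
    ∑ ω ∈ saws d m, eCount d k m ω =
      ∑ i ∈ Finset.range m, bridgeCount d i * irreducibleBridgeCount d (k - i) := by
  classical
  rw [← card_noBreak d k m hm hmk]
  -- classify `noBreak` by the head `β[0,m]`: `noBreak ≃ Σ_{ω ∈ S_m} E_k(ω)`
  have hcard : ((saws d m).sigma fun ω => eSet k m ω).card = ∑ ω ∈ saws d m, eCount d k m ω := by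
    rw [card_sigma]
    refine Finset.sum_congr rfl fun ω _ => ?_
    rw [eCount_eq_card]
  rw [← hcard]
  symm
  refine card_nbij (fun β => (⟨fun i => β (min i m), β⟩ : Σ _ : ℕ → Site d, ℕ → Site d)) ?_ ?_ ?_
  · intro β hβ
    rw [mem_coe, mem_noBreak] at hβ
    obtain ⟨hβb, hβE⟩ := hβ
    rw [mem_coe, mem_sigma]
    refine ⟨head_mem_saws (mem_bridges.1 hβb).1 hmk, mem_eSet.2 ⟨hβb, fun j hj => ?_, hβE⟩⟩
    simp only [min_eq_left hj]
  · intro β _ β' _ h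
    have h2 := (Sigma.mk.inj_iff.1 h).2
    exact eq_of_heq h2
  · rintro ⟨ω, β⟩ hp
    simp only [mem_coe, mem_sigma] at hp
    obtain ⟨hω, hβ⟩ := hp
    obtain ⟨hβb, hβω, hβE⟩ := mem_eSet.1 hβ
    obtain ⟨-, hωend, -, -⟩ := mem_saws.1 hω
    refine ⟨β, ?_, ?_⟩
    · rw [mem_coe, mem_noBreak]; exact ⟨hβb, hβE⟩
    · have hhead : (fun i => β (min i m)) = ω := funext fun i => by
        rcases le_or_gt i m with hi | hi
        · rw [min_eq_left hi]; exact hβω i hi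
        · rw [min_eq_right hi.le, hβω m le_rfl, hωend i hi.le]
      simp only [hhead]

/-- **Madras–Slade (8.3.8), pointwise**: for `1 ≤ m ≤ k` and an `m`-step walk `ω`,
`|E_k(ω)| ≤ Σ_{i<m} λ_{k-i}` (one term sharper than the printed `Σ_{i=0}^{m}`): `β ∈ E_k(ω)` is determined
by its last break point `i < m` and the irreducible bridge `β[i, k]`, since `β[0, i] = ω[0, i]`.
[cite: MadrasSlade1993, §8.3, eq. (8.3.8) (p. 273)] -/
theorem eCount_le_sum_irreducibleBridgeCount (k m : ℕ) (hm : 1 ≤ m) (hmk : m ≤ k) (ω : ℕ → Site d) :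
    eCount d k m ω ≤ ∑ i ∈ Finset.range m, irreducibleBridgeCount d (k - i) := by
  classical
  have hcard : ((Finset.range m).sigma fun i => irreducibleBridges d (k - i)).card =
      ∑ i ∈ Finset.range m, irreducibleBridgeCount d (k - i) := by
    rw [card_sigma]; rfl
  rw [← hcard, eCount_eq_card]
  -- `β ↦ (last break point I < m, tail after I)` is injective on `E_k(ω)`
  refine Finset.card_le_card_of_injOn
    (fun β => ⟨Nat.findGreatest (fun j => IsRenewalTime k β j) (m - 1),
      fun j => β (Nat.findGreatest (fun j => IsRenewalTime k β j) (m - 1) + j) -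
        β (Nat.findGreatest (fun j => IsRenewalTime k β j) (m - 1))⟩) ?_ ?_
  · intro β hβ
    rw [mem_coe, mem_eSet] at hβ
    obtain ⟨hβb, -, hβE⟩ := hβ
    have hβbr : IsBridge k β := (mem_bridges.1 hβb).2
    set I := Nat.findGreatest (fun j => IsRenewalTime k β j) (m - 1) with hIdef
    have hI : IsRenewalTime k β I := by
      have h0 : IsRenewalTime k β 0 := isRenewalTime_zero hβbr
      by_cases hI0 : I = 0
      · rw [hI0]; exact h0
      · exact Nat.findGreatest_of_ne_zero hIdef.symm hI0
    have hIm : I ≤ m - 1 := Nat.findGreatest_le _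
    have hmax : ∀ j, I < j → j ≤ m - 1 → ¬ IsRenewalTime k β j := fun j hIj hjm =>
      Nat.findGreatest_is_greatest hIj hjm
    simp only [mem_coe, mem_sigma, Finset.mem_range]
    refine ⟨by omega, ?_⟩
    have htail := tailShift_mem_bridges hβb hI
    refine mem_irreducibleBridges.2 ⟨htail, by omega, (mem_bridges.1 htail).2, fun j hj1 hj2 hren => ?_⟩
    have hren' : IsRenewalTime (k - I) (fun i => β (I + i)) j :=
      (isRenewalTime_sub_const_iff (ω := fun i => β (I + i)) (β I)).1 hren
    have hβj : IsRenewalTime k β (I + j) := hI.add_of_tail hren'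
    by_cases hjm : I + j ≤ m - 1
    · exact hmax (I + j) (by omega) hjm hβj
    · exact hβE (I + j) (by omega) (by omega) hβj
  · intro β hβ β' hβ' h
    rw [mem_coe, mem_eSet] at hβ hβ'
    obtain ⟨-, hβω, -⟩ := hβ
    obtain ⟨-, hβω', -⟩ := hβ'
    simp only [Sigma.mk.injEq] at h
    obtain ⟨hI, htl⟩ := h
    set I := Nat.findGreatest (fun j => IsRenewalTime k β j) (m - 1) with hIdef
    have hIm : I ≤ m - 1 := Nat.findGreatest_le _
    rw [← hI] at htl
    have htl' := eq_of_heq htl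
    -- both walks have the same head `ω[0, I]` and the same tail
    have hhead : (fun i => β (min i I)) = fun i => β' (min i I) := by
      funext i
      have hi : min i I ≤ m := by omega
      rw [hβω _ hi, hβω' _ hi]
    rw [← concatWalk_head_tail (s := I) β, ← concatWalk_head_tail (s := I) β', hhead, htl']

/-! ### Every bridge extends exactly one `m`-step walk: `Σ_{ω ∈ S_m} |F_n(ω) ∩ B_n| = b_n` -/

variable (d) in
/-- For `m ≤ n`, `Σ_{ω ∈ S_m} |F_n(ω) ∩ B_n| = b_n`: an `n`-step bridge extends exactly one `m`-step
self-avoiding walk, its own head `β[0,m]`. [cite: MadrasSlade1993, §8.3, eq. (8.3.2)] -/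
theorem sum_bridgeExtCount_eq (n m : ℕ) (hmn : m ≤ n) :
    ∑ ω ∈ saws d m, bridgeExtCount d n m ω = bridgeCount d n := by
  classical
  have hcard : ((saws d m).sigma fun ω =>
      (bridges d n).filter fun β : ℕ → Site d => ∀ j, j ≤ m → β j = ω j).card =
      ∑ ω ∈ saws d m, bridgeExtCount d n m ω := by
    rw [card_sigma]
    refine Finset.sum_congr rfl fun ω _ => ?_
    rw [bridgeExtCount]
  rw [← hcard, bridgeCount]
  symm
  refine card_nbij (fun β => (⟨fun i => β (min i m), β⟩ : Σ _ : ℕ → Site d, ℕ → Site d)) ?_ ?_ ?_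
  · intro β hβ
    rw [mem_coe] at hβ
    rw [mem_coe, mem_sigma]
    refine ⟨head_mem_saws (mem_bridges.1 hβ).1 hmn, Finset.mem_filter.2 ⟨hβ, fun j hj => ?_⟩⟩
    simp only [min_eq_left hj]
  · intro β _ β' _ h
    exact eq_of_heq (Sigma.mk.inj_iff.1 h).2
  · rintro ⟨ω, β⟩ hp
    simp only [mem_coe, mem_sigma] at hp
    obtain ⟨hω, hβ⟩ := hp
    obtain ⟨hβb, hβω⟩ := Finset.mem_filter.1 hβ
    obtain ⟨-, hωend, -, -⟩ := mem_saws.1 hω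
    refine ⟨β, ?_, ?_⟩
    · rw [mem_coe]; exact hβb
    · have hhead : (fun i => β (min i m)) = ω := funext fun i => by
        rcases le_or_gt i m with hi | hi
        · rw [min_eq_left hi]; exact hβω i hi
        · rw [min_eq_right hi.le, hβω m le_rfl, hωend i hi.le]
      simp only [hhead]

variable (d) in
/-- `Σ_{ω ∈ S_m} P^B_{m,n}(ω) = 1` for `m ≤ n`. [cite: MadrasSlade1993, §8.3, eq. (8.3.2)] -/
theorem sum_bridgeCylProb_eq_one (n m : ℕ) (hmn : m ≤ n) :
    ∑ ω ∈ saws d m, bridgeCylProb d m n ω = 1 := by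
  have hb : (0 : ℝ) < bridgeCount d n := by exact_mod_cast one_le_bridgeCount (d := d) n
  unfold bridgeCylProb
  rw [← Finset.sum_div, div_eq_one_iff_eq hb.ne']
  exact_mod_cast sum_bridgeExtCount_eq d n m hmn

/-! ### Normalisation of Kesten's cylinder weights: `Σ_{ω ∈ S_m} P^B_m(ω) = 1` -/

variable (d) in
/-- The `ω`-summed cylinder weights at length `k ≥ m`: `Σ_{ω ∈ S_m} |E_k(ω)| μ^{-k} = Σ_{i<m} (b_i μ^{-i})(λ_{k-i} μ^{-(k-i)})`.
[cite: MadrasSlade1993, §8.3, eq. (8.3.8)] -/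
private theorem sum_eCount_weight (k m : ℕ) (hm : 1 ≤ m) :
    ∑ ω ∈ saws d m, (eCount d k m ω : ℝ) * (connectiveConstant d ^ k)⁻¹ =
      ∑ i ∈ Finset.range m,
        if m ≤ k then
          (bridgeCount d i : ℝ) / connectiveConstant d ^ i *
            ((irreducibleBridgeCount d (k - i) : ℝ) / connectiveConstant d ^ (k - i))
        else 0 := by
  set μ := connectiveConstant d with hμdef
  have hμ : 0 < μ := connectiveConstant_pos d
  by_cases hmk : m ≤ k
  · simp only [if_pos hmk]
    rw [← Finset.sum_mul]
    have h := sum_eCount_eq d k m hm hmk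
    have h' : (∑ ω ∈ saws d m, (eCount d k m ω : ℝ)) =
        ∑ i ∈ Finset.range m, (bridgeCount d i : ℝ) * (irreducibleBridgeCount d (k - i) : ℝ) := by
      exact_mod_cast h
    rw [h', Finset.sum_mul]
    refine Finset.sum_congr rfl fun i hi => ?_
    have him : i < m := Finset.mem_range.1 hi
    have hik : i ≤ k := by omega
    have hpow : μ ^ k = μ ^ i * μ ^ (k - i) := by rw [← pow_add, Nat.add_sub_cancel' hik]
    rw [hpow]
    field_simp
  · simp only [if_neg hmk, Finset.sum_const_zero]
    refine Finset.sum_eq_zero fun ω hω => ?_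
    rw [eCount_eq_zero_of_lt hω (by omega)]
    simp

variable (d) in
/-- The `ω`-summed cylinder weights sum to one over all lengths: `Σ_k Σ_{ω ∈ S_m} |E_k(ω)| μ^{-k} = 1`
(the renewal conservation law (B.5) `Σ_{i<m} (b_i μ^{-i}) · (1 - Σ_{s<m-i} λ_s μ^{-s}) = 1` with
Kesten's relation (4.2.4)). [cite: MadrasSlade1993, §8.3, p. 273; Appendix B, eq. (B.5)] -/
private theorem hasSum_sum_eCount_weight (m : ℕ) (hm : 1 ≤ m) :
    HasSum (fun k => ∑ ω ∈ saws d m, (eCount d k m ω : ℝ) * (connectiveConstant d ^ k)⁻¹) 1 := by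
  set μ := connectiveConstant d with hμdef
  have hμ : 0 < μ := connectiveConstant_pos d
  set a : ℕ → ℝ := fun i => (bridgeCount d i : ℝ) / μ ^ i with hadef
  set p : ℕ → ℝ := fun s => (irreducibleBridgeCount d s : ℝ) / μ ^ s with hpdef
  have hp : HasSum p 1 := MadrasSlade1993_eq424_holds d
  -- the pieces `h i k = [m ≤ k] a_i p_{k-i}`
  set h : ℕ → ℕ → ℝ := fun i k => if m ≤ k then a i * p (k - i) else 0 with hhdef
  have hfun : (fun k => ∑ ω ∈ saws d m, (eCount d k m ω : ℝ) * (μ ^ k)⁻¹) =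
      fun k => ∑ i ∈ Finset.range m, h i k := by
    funext k
    rw [sum_eCount_weight d k m hm]
  rw [hfun]
  -- each piece sums to `a_i · (1 - Σ_{s < m-i} p_s)`
  have hpiece : ∀ i ∈ Finset.range m,
      HasSum (h i) (a i * (1 - ∑ s ∈ Finset.range (m - i), p s)) := by
    intro i hi
    have him : i < m := Finset.mem_range.1 hi
    have hshift : HasSum (fun s => p (s + (m - i))) (1 - ∑ s ∈ Finset.range (m - i), p s) :=
      (hasSum_nat_add_iff' (m - i)).2 hp
    have hshift' : HasSum (fun s => a i * p (s + (m - i))) (a i * (1 - ∑ s ∈ Finset.range (m - i), p s)) :=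
      hshift.mul_left (a i)
    have h0 : ∑ j ∈ Finset.range m, h i j = 0 := by
      refine Finset.sum_eq_zero fun j hj => ?_
      have hjm : j < m := Finset.mem_range.1 hj
      simp only [hhdef, if_neg (not_le.2 hjm)]
    refine (hasSum_nat_add_iff' m).1 ?_
    rw [h0, sub_zero]
    have heq : (fun s => h i (s + m)) = fun s => a i * p (s + (m - i)) := by
      funext s
      simp only [hhdef, if_pos (Nat.le_add_left m s)]
      congr 2
      omega
    rw [heq]
    exact hshift'
  have htot := hasSum_sum hpiece
  -- the total is `1` by the conservation law (B.5) at `n = m - 1`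
  have hB5 : ∑ i ∈ Finset.range m, a i * (1 - ∑ s ∈ Finset.range (m - i), p s) = 1 := by
    set r : ℕ → ℝ := fun n => 1 - ∑ k ∈ Finset.range (n + 1), p k with hrdef
    have hr : ∀ n, r n = 1 - ∑ k ∈ Finset.range (n + 1), p k := fun n => rfl
    have hu0 : a 0 = 1 := bridgeCount_div_pow_zero d
    have hf0 : p 0 = 0 := irreducibleBridgeCount_div_pow_zero d
    have hren : ∀ n, 1 ≤ n → a n = ∑ k ∈ Finset.range (n + 1), p k * a (n - k) :=
      fun n hn => MadrasSlade1993_eq425 d hn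
    have h := _root_.Literature.Probability.Process.Renewal.sum_tailSum_mul_eq_one hr hu0 hf0 hren (m - 1)
    rw [show m - 1 + 1 = m by omega] at h
    calc ∑ i ∈ Finset.range m, a i * (1 - ∑ s ∈ Finset.range (m - i), p s)
        = ∑ k ∈ Finset.range m, a (m - 1 - k) * (1 - ∑ s ∈ Finset.range (m - (m - 1 - k)), p s) :=
          (Finset.sum_range_reflect (fun i => a i * (1 - ∑ s ∈ Finset.range (m - i), p s)) m).symm
      _ = ∑ k ∈ Finset.range m, r k * a (m - 1 - k) := by
          refine Finset.sum_congr rfl fun k hk => ?_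
          have hkm : k < m := Finset.mem_range.1 hk
          rw [hr, show m - (m - 1 - k) = k + 1 by omega, mul_comm]
      _ = 1 := h
  rwa [hB5] at htot

variable (d) in
/-- **Normalisation of Kesten's infinite-bridge measure on `m`-cylinders**: for `m ≥ 1`,
`Σ_{ω ∈ S_m} P^B_m(ω) = 1` (Madras–Slade p. 273: the cylinder weights (8.3.6) are a consistent family
of probability measures). Each `P^B_m(ω)` is a convergent series.
[cite: MadrasSlade1993, §8.3, Theorem 8.3.1 and eq. (8.3.6) (p. 273)] -/
theorem sum_kestenCyl_eq_one (m : ℕ) (hm : 1 ≤ m) :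
    ∑ ω ∈ saws d m, kestenCyl d m ω = 1 := by
  set μ := connectiveConstant d with hμdef
  have hμ : 0 < μ := connectiveConstant_pos d
  have hg := hasSum_sum_eCount_weight d m hm
  -- each cylinder series converges (domination by the `ω`-summed series)
  have hterm : ∀ ω ∈ saws d m,
      HasSum (fun k => (eCount d k m ω : ℝ) * (μ ^ k)⁻¹) (kestenCyl d m ω) := by
    intro ω hω
    have hsum : Summable (fun k => (eCount d k m ω : ℝ) * (μ ^ k)⁻¹) := by
      refine Summable.of_nonneg_of_le (fun k => by positivity) (fun k => ?_) hg.summable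
      have : (eCount d k m ω : ℝ) * (μ ^ k)⁻¹ ≤ ∑ ω' ∈ saws d m, (eCount d k m ω' : ℝ) * (μ ^ k)⁻¹ :=
        Finset.single_le_sum (f := fun ω' => (eCount d k m ω' : ℝ) * (μ ^ k)⁻¹)
          (fun ω' _ => by positivity) hω
      exact this
    have hK : kestenCyl d m ω = ∑' k, (eCount d k m ω : ℝ) * (μ ^ k)⁻¹ := by
      rw [kestenCyl]
      refine tsum_congr fun k => ?_
      rw [zpow_neg, zpow_natCast]
    rw [hK]
    exact hsum.hasSum
  have htot := hasSum_sum hterm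
  exact (HasSum.unique htot hg)

/-! ### Madras–Slade Theorem 8.3.1, unconditional -/

/-- **Madras–Slade Theorem 8.3.1 (Kesten's infinite-bridge measure), unconditional, every dimension
`d + 2 ≥ 2`:** for an `m`-step self-avoiding walk `ω` (`m ≥ 1`), the series `P^B_m(ω) = Σ_k |E_k(ω)| μ^{-k}`
((8.3.6)) converges and the fraction `P^B_{m,n}(ω)` of `n`-step bridges extending `ω` converges to it as
`n → ∞` ((8.3.3)). Assembled from `MadrasSlade1993_thm831_of_eq835_eq838` (`SAWKestenBridgeMeasure.lean`)
and the identities (8.3.5) `bridgeExtCount_eq_sum_eCount`, (8.3.8) `eCount_le_sum_irreducibleBridgeCount`.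
[cite: MadrasSlade1993, Theorem 8.3.1 (p. 273)] -/
theorem MadrasSlade1993_thm831 {d m : ℕ} (hm : 1 ≤ m) {ω : ℕ → Site (d + 2)}
    (hω : ω ∈ saws (d + 2) m) :
    Summable (fun k => (eCount (d + 2) k m ω : ℝ) / connectiveConstant (d + 2) ^ k) ∧
      Tendsto (fun n => bridgeCylProb (d + 2) m n ω) atTop (𝓝 (kestenCyl (d + 2) m ω)) :=
  MadrasSlade1993_thm831_of_eq835_eq838 hω (fun n hn => bridgeExtCount_eq_sum_eCount n m hn ω)
    fun k hk => eCount_le_sum_irreducibleBridgeCount k m hm hk ω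

end Literature.Probability.RandomPlanarGeometry.SAW.Zd

end
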